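import Summits.BirchSwinnertonDyer.BirchSwinnertonDyer.Theorems.ResidualThetaTransportAtTwoResidualSignedLambdaLowerCMAtTwoRhoLayerPairingProjection
import HarnessLib

/-!
# K-c (coeff): `ℤ_p`-SEMILINEARITY of the pinned `ρ`-coefficient layer Tate pairings in the Kato class, and the `C`-step of the glue `locd₂`
# (`locd₂ (C a • x) = c • locd₂ x`) — LIN-C₀ of the v2b piece S2 `stub_plusColemanO`

Route `ResidualThetaTransportAtTwo` (RTT), crux RSL_g `ResidualSignedLambdaLowerCMAtTwo` (stmt-BirchSwinnertonDyer-22608); width seat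
`bsd-wall-tp2-p2x-w2` g18 (`--supports`, closes nothing). THEOREMS ONLY (no definition, no named fact, no instance, no `sorry`). BSD is not proved
by any of this; RSL_g is not proved here. Companion of `…RhoLayerPairingConj.lean` (LIN-X): this file is LIN-C₀ of STUB-PLAN rev 17 S72 / card k3-g12
(`hC : 𝒸 (j (C a) • x) = C a • 𝒸 x` for `𝒸 = col^{⊕r} ∘ locd₂`, `j (C a) = C (ι a)`, `ι = padicIntToCoeffIntegers S : ℤ_p →+* 𝒪`).

WHAT.
* §1 (`ρ`, the scalars `ι c`, `c ∈ ℤ_p`): **`divPowCofreeMkTorsion_padicInt_smul`** — `div_k (ι c • t) = (c mod p^k) • div_k t` in `A_ρ[p^k]` (write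
  `c = (c mod p^k) + p^k c'`; `A_ρ[p^k]` is killed by `p^k`); **`reduceH1CofreePkTorsion_padicInt_smul`** (`red_{p^k} (ι c • y) = (c mod p^k) • red_{p^k} y` on
  `H¹(U, ·)`, on cocycles); **`rhoLayerPairingPk_padicInt_smul`** (`rhoLayerPairingPk n k (ι c • y) Q = (c mod p^k) · rhoLayerPairingPk n k y Q`);
  **`rhoLayerPairingAdic_padicInt_smul`** and **`pair_padicInt_smul_of_toZModPow`** (`pair n (ι c • y) Q = c · pair n y Q` for THE pinned `ℤ_p`-valued family
  and for every family `pair` PINNED by its residues — the binder currency of the registered `Lines/onepair.lean`).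
* §2 (generic `T` with coefficients `A`, `I : IwasawaH1DataCoeff T p κ γ`, any `pair` that is `ℤ_p`-semilinear for a scalar `a ∈ A` over `c ∈ ℤ_p`, any `locd₂`
  with the layer formula of K-c `exists_locd₂_of_layerCores`): **`locd₂_C_smul`** (`locd₂ (C a • x) Q = c · locd₂ x Q`, from `IwasawaH1DataCoeff.proj_C_smul`),
  `locd₂_C_smul_eq_smul`, and LIN-C₀ packaged: **`colTuple_locd₂_C_smul`** — for any `ℤ_p`-linear `col`, `𝒸 (C a • x) = c • 𝒸 x` where
  `𝒸 x = (col (locd₂ x ∘ single_i))_i`.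

References: [Kato2004Asterisque] §12.2 (p. 220), §13.8 (pp. 228–229), §14.9 (p. 239); [PerrinRiou1994Invent] §3.6.1; [Kobayashi2003] (8.23) (p. 18);
[Greenberg1989] §1 (p. 98); [SerreGaloisCohomology1997] I §2.2.
-/

set_option autoImplicit false
-- the Theorems namespace of this sub repeats the summit name by design (D-0017 nested layout)
set_option linter.dupNamespace false

noncomputable section

open scoped Classical

namespace Summit.BirchSwinnertonDyer.BirchSwinnertonDyer.Theorems.ThetaTransport

open CategoryTheory Field NumberField IsDedekindDomain WeierstrassCurve
  Literature.NumberTheory.EllipticCurves Literature.NumberTheory.GaloisRepresentations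
  Literature.NumberTheory.EllipticCurves.Kobayashi2003 Literature.NumberTheory.EllipticCurves.Sprung2012
  Literature.NumberTheory.EllipticCurves.GreenbergSelmer Literature.NumberTheory.EllipticCurves.CyclotomicLayer
  Literature.NumberTheory.EllipticCurves.Kato2004
  Literature.NumberTheory.GaloisCohomology ZpExtension

/-! ## §1 `ρ`: `ι c` acts on the reductions modulo `p^k` as the integer `c mod p^k` -/

section Rho

variable {p : ℕ} [Fact p.Prime] (S : Set (PadicAlgCl p)) {d : ℕ} (ρ : FramedGaloisRep ℚ ↥(padicCoeffIntegers S) d) (k : ℕ)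

/-- `c = (c mod p^k) + p^k·c'` in `ℤ_p` (`PadicInt.ker_toZModPow`). [cite: SerreLocalFields1979, II §2] -/
theorem exists_eq_val_add_pow_mul (c : ℤ_[p]) :
    ∃ c' : ℤ_[p], c = ((PadicInt.toZModPow k c).val : ℤ_[p]) + (p : ℤ_[p]) ^ k * c' := by
  have hmem : c - ((PadicInt.toZModPow k c).val : ℤ_[p]) ∈ RingHom.ker (PadicInt.toZModPow (p := p) k) := by
    rw [RingHom.mem_ker, map_sub, map_natCast, ZMod.natCast_zmod_val, sub_self]
  rw [PadicInt.ker_toZModPow, Ideal.mem_span_singleton] at hmem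
  obtain ⟨c', hc'⟩ := hmem
  exact ⟨c', by rw [← hc']; ring⟩

/-- `A_ρ[p^k]` is killed by `p^k`: `p^k • div_k t = 0` (`pow_smul_divPowCofreeMk`). [cite: Greenberg1989, §1 p. 98] -/
theorem pow_nsmul_divPowCofreeMkTorsion (t : Fin d → ↥(padicCoeffIntegers S)) :
    p ^ k • divPowCofreeMkTorsion S ρ k t = 0 :=
  Subtype.ext (by rw [AddSubmonoidClass.coe_nsmul, coe_divPowCofreeMkTorsion_apply, pow_smul_divPowCofreeMk]; rfl)

/-- **`div_k (ι c • t) = (c mod p^k) • div_k t`** in `A_ρ[p^k]` for `c ∈ ℤ_p`, `ι = padicIntToCoeffIntegers S`: write `c = (c mod p^k) + p^k c'`; `div_k` is additive and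
`p^k` kills `A_ρ[p^k]`. [cite: Kato2004Asterisque, §13.8 (p. 228)] [cite: Greenberg1989, §1 p. 98] -/
theorem divPowCofreeMkTorsion_padicInt_smul (c : ℤ_[p]) (t : Fin d → ↥(padicCoeffIntegers S)) :
    divPowCofreeMkTorsion S ρ k (padicIntToCoeffIntegers S c • t) = (PadicInt.toZModPow k c).val • divPowCofreeMkTorsion S ρ k t := by
  obtain ⟨c', hc⟩ := exists_eq_val_add_pow_mul k c
  have hsmul : padicIntToCoeffIntegers S c • t =
      (PadicInt.toZModPow k c).val • t + p ^ k • (padicIntToCoeffIntegers S c' • t) := by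
    conv_lhs => rw [hc]
    rw [map_add, map_mul, map_pow, map_natCast, map_natCast, add_smul, mul_smul, ← Nat.cast_pow, Nat.cast_smul_eq_nsmul,
      Nat.cast_smul_eq_nsmul]
  rw [hsmul, map_add, map_nsmul, map_nsmul, pow_nsmul_divPowCofreeMkTorsion, add_zero]

/-- **`H¹`-functoriality along an additive map carries a scalar acting as an integer on the values to that integer**: if `f (a • x) = m • f x` for all `x`
(`a ∈ R`, `m ∈ ℕ`), then `f_* (a • c) = m • f_* c = f_* (m • c)` on `H¹` (on cocycles, `mapH1AddHom_oneCocycleClass`). [cite: SerreGaloisCohomology1997, I §2.2] -/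
theorem mapH1AddHom_smul_of_forall_eq_nsmul {R : Type} [Ring R] [TopologicalSpace R] {R' : Type} [Ring R'] [TopologicalSpace R']
    {G : Type} [Group G] [TopologicalSpace G] [IsTopologicalGroup G] {X : TopRep.{0} R G} {Y : TopRep.{0} R' G}
    (f : X →+ Y) (hf : Continuous f) (hρ : ∀ (g : G) (x : X), f (X.ρ g x) = Y.ρ g (f x)) (a : R) (m : ℕ)
    (ha : ∀ x : X, f (a • x) = m • f x) (c : continuousCohomology 1 X) :
    mapH1AddHom X Y f hf hρ (a • c) = m • mapH1AddHom X Y f hf hρ c := by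
  obtain ⟨φ, rfl⟩ := oneCocycleClass_surjective _ c
  rw [← oneCocycleClass_smul, mapH1AddHom_oneCocycleClass, mapH1AddHom_oneCocycleClass, ← Nat.cast_smul_eq_nsmul R',
    ← oneCocycleClass_smul]
  congr 1
  apply Subtype.ext
  ext g
  rw [contOneCocycles.pushAddHom_apply, Submodule.coe_smul, ContinuousMap.smul_apply, Submodule.coe_smul, ContinuousMap.smul_apply,
    contOneCocycles.pushAddHom_apply, ha, Nat.cast_smul_eq_nsmul]

/-- Same, read at the source: `f_* (a • c) = f_* (m • c)`. [cite: SerreGaloisCohomology1997, I §2.2] -/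
theorem mapH1AddHom_smul_eq_mapH1AddHom_nsmul {R : Type} [Ring R] [TopologicalSpace R] {R' : Type} [Ring R'] [TopologicalSpace R']
    {G : Type} [Group G] [TopologicalSpace G] [IsTopologicalGroup G] {X : TopRep.{0} R G} {Y : TopRep.{0} R' G}
    (f : X →+ Y) (hf : Continuous f) (hρ : ∀ (g : G) (x : X), f (X.ρ g x) = Y.ρ g (f x)) (a : R) (m : ℕ)
    (ha : ∀ x : X, f (a • x) = m • f x) (c : continuousCohomology 1 X) :
    mapH1AddHom X Y f hf hρ (a • c) = mapH1AddHom X Y f hf hρ (m • c) := by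
  rw [map_nsmul, mapH1AddHom_smul_of_forall_eq_nsmul f hf hρ a m ha c]

/-- **`red_{p^k} (ι c • y) = red_{p^k} ((c mod p^k) • y)`** on `H¹(U, ·)` (`U ≤ Γ_ℚ`): on cocycles `div_k ∘ (ι c • φ) = (c mod p^k) • (div_k ∘ φ)`
(`divPowCofreeMkTorsion_padicInt_smul`). [cite: Kato2004Asterisque, §13.8 (pp. 228–229)] [cite: SerreGaloisCohomology1997, I §2.2] -/
theorem reduceH1CofreePkTorsion_padicInt_smul (U : Subgroup (absoluteGaloisGroup ℚ)) (c : ℤ_[p]) (y : H1 (FramedGaloisRep.toGaloisRep ρ) U) :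
    reduceH1CofreePkTorsion S ρ k U (padicIntToCoeffIntegers S c • y) =
      reduceH1CofreePkTorsion S ρ k U ((PadicInt.toZModPow k c).val • y) :=
  mapH1AddHom_smul_eq_mapH1AddHom_nsmul (X := subgroupRep (FramedGaloisRep.toGaloisRep ρ).toTopRep U)
    (Y := discreteTopRep U ↥(AddSubgroup.torsionBy (Cofree ρ ↥(padicCoeffField S)) ((p ^ k : ℕ) : ℤ)))
    (divPowCofreeMkTorsion S ρ k) (continuous_divPowCofreeMkTorsion S ρ k) (divPowCofreeMkTorsion_subgroupRep S ρ k U)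
    (padicIntToCoeffIntegers S c) (PadicInt.toZModPow k c).val (divPowCofreeMkTorsion_padicInt_smul S ρ k c) y

variable (W : WeierstrassCurve ℚ) [W.IsElliptic] {r : ℕ}
  (ePk : ∀ k : ℕ, ↥(AddSubgroup.torsionBy (Cofree ρ ↥(padicCoeffField S)) ((p ^ k : ℕ) : ℤ)) →
    ↥(AddSubgroup.torsionBy (Cofree ρ ↥(padicCoeffField S)) ((p ^ k : ℕ) : ℤ)) → AlgebraicClosure ℚ)
  (hμPk : ∀ k a b, ePk k a b ^ (p ^ k) = 1)
  (hadd₁Pk : ∀ k a₁ a₂ b, ePk k (a₁ + a₂) b = ePk k a₁ b * ePk k a₂ b)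
  (hadd₂Pk : ∀ k a b₁ b₂, ePk k a (b₁ + b₂) = ePk k a b₁ * ePk k a b₂)
  (hgalPk : ∀ k (σ : absoluteGaloisGroup ℚ) (a b : ↥(AddSubgroup.torsionBy (Cofree ρ ↥(padicCoeffField S)) ((p ^ k : ℕ) : ℤ))),
    σ • ePk k a b = ePk k (cofreeTorsionGaloisModule S ρ _ σ a) (cofreeTorsionGaloisModule S ρ _ σ b))
  (Θ : Cofree ρ ↥(padicCoeffField S) ≃+ (Fin r → ↥(W.geomPrimaryTorsion p))) (κ : ZpExtension ℚ p)
  (v : HeightOneSpectrum (𝓞 ℚ))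
  (hΘ : ∀ (δ : absoluteGaloisGroup (v.adicCompletion ℚ)) (m : Cofree ρ ↥(padicCoeffField S)) (i : Fin r),
    Θ (resGalOfEmb (closureEmb (K := ℚ) (v.adicCompletion ℚ)) δ • m) i =
      resGalOfEmb (closureEmb (K := ℚ) (v.adicCompletion ℚ)) δ • Θ m i)

/-- **`ℤ_p`-semilinearity modulo `p^k`**: `rhoLayerPairingPk n k (ι c • y) Q = (c mod p^k) · rhoLayerPairingPk n k y Q` — the reduction carries `ι c` to the
integer `c mod p^k` (`reduceH1CofreePkTorsion_padicInt_smul`), and `rhoLayerPairingPk n k` is additive in the class (`map_nsmul`).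
[cite: Kato2004Asterisque, §13.8 (pp. 228–229), §14.9 (p. 239)] [cite: Kobayashi2003, (8.23) (p. 18)] -/
theorem rhoLayerPairingPk_padicInt_smul (n : ℕ) (c : ℤ_[p]) (y : H1 (FramedGaloisRep.toGaloisRep ρ) (κ.layerSubgroup n))
    (Q : Fin r → localLayerPointsOfEmb κ (closureEmb (K := ℚ) (v.adicCompletion ℚ)) W n) :
    rhoLayerPairingPk S ρ W ePk hμPk hadd₁Pk hadd₂Pk hgalPk Θ κ v hΘ n k (padicIntToCoeffIntegers S c • y) Q =
      PadicInt.toZModPow k c * rhoLayerPairingPk S ρ W ePk hμPk hadd₁Pk hadd₂Pk hgalPk Θ κ v hΘ n k y Q := by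
  have h : rhoLayerPairingPk S ρ W ePk hμPk hadd₁Pk hadd₂Pk hgalPk Θ κ v hΘ n k (padicIntToCoeffIntegers S c • y) =
      rhoLayerPairingPk S ρ W ePk hμPk hadd₁Pk hadd₂Pk hgalPk Θ κ v hΘ n k ((PadicInt.toZModPow k c).val • y) := by
    refine AddMonoidHom.ext fun Q => ?_
    rw [rhoLayerPairingPk_apply, rhoLayerPairingPk_apply, reduceH1CofreePkTorsion_padicInt_smul]
  rw [h, map_nsmul, AddMonoidHom.nsmul_apply, nsmul_eq_mul, ZMod.natCast_zmod_val]

/-- **`ℤ_p`-linearity in the class for THE pinned `ℤ_p`-valued family**: `rhoLayerPairingAdic n (ι c • y) Q = c · rhoLayerPairingAdic n y Q`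
(residue-wise, `PadicInt.ext_of_toZModPow`). [cite: PerrinRiou1994Invent, §3.6.1] [cite: Kato2004Asterisque, §13.8 (pp. 228–229)] -/
theorem rhoLayerPairingAdic_padicInt_smul (n : ℕ)
    (hcompat : ∀ (k : ℕ) (x : H1 (FramedGaloisRep.toGaloisRep ρ) (κ.layerSubgroup n))
      (Q : Fin r → localLayerPointsOfEmb κ (closureEmb (K := ℚ) (v.adicCompletion ℚ)) W n),
      (ZMod.cast (rhoLayerPairingPk S ρ W ePk hμPk hadd₁Pk hadd₂Pk hgalPk Θ κ v hΘ n (k + 1) x Q) : ZMod (p ^ k)) =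
        rhoLayerPairingPk S ρ W ePk hμPk hadd₁Pk hadd₂Pk hgalPk Θ κ v hΘ n k x Q)
    (c : ℤ_[p]) (y : H1 (FramedGaloisRep.toGaloisRep ρ) (κ.layerSubgroup n))
    (Q : Fin r → localLayerPointsOfEmb κ (closureEmb (K := ℚ) (v.adicCompletion ℚ)) W n) :
    rhoLayerPairingAdic S ρ W ePk hμPk hadd₁Pk hadd₂Pk hgalPk Θ κ v hΘ n hcompat (padicIntToCoeffIntegers S c • y) Q =
      c * rhoLayerPairingAdic S ρ W ePk hμPk hadd₁Pk hadd₂Pk hgalPk Θ κ v hΘ n hcompat y Q :=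
  PadicInt.ext_of_toZModPow.mp fun k => by
    rw [map_mul, toZModPow_rhoLayerPairingAdic, toZModPow_rhoLayerPairingAdic, rhoLayerPairingPk_padicInt_smul]

/-- **`ℤ_p`-linearity in the class for EVERY family PINNED by its residues** (the `pair` binder of the registered `Lines/onepair.lean`):
`pair n (ι c • y) Q = c · pair n y Q`. [cite: PerrinRiou1994Invent, §3.6.1] [cite: Kato2004Asterisque, §13.8 (pp. 228–229)] -/
theorem pair_padicInt_smul_of_toZModPow
    (pair : ∀ n : ℕ, H1 (FramedGaloisRep.toGaloisRep ρ) (κ.layerSubgroup n) →+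
      ((Fin r → localLayerPointsOfEmb κ (closureEmb (K := ℚ) (v.adicCompletion ℚ)) W n) →+ ℤ_[p]))
    (hpair : ∀ (n k : ℕ) (x : H1 (FramedGaloisRep.toGaloisRep ρ) (κ.layerSubgroup n))
      (Q : Fin r → localLayerPointsOfEmb κ (closureEmb (K := ℚ) (v.adicCompletion ℚ)) W n),
      PadicInt.toZModPow k (pair n x Q) = rhoLayerPairingPk S ρ W ePk hμPk hadd₁Pk hadd₂Pk hgalPk Θ κ v hΘ n k x Q)
    (n : ℕ) (c : ℤ_[p]) (y : H1 (FramedGaloisRep.toGaloisRep ρ) (κ.layerSubgroup n))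
    (Q : Fin r → localLayerPointsOfEmb κ (closureEmb (K := ℚ) (v.adicCompletion ℚ)) W n) :
    pair n (padicIntToCoeffIntegers S c • y) Q = c * pair n y Q :=
  PadicInt.ext_of_toZModPow.mp fun k => by
    rw [map_mul, hpair, hpair, rhoLayerPairingPk_padicInt_smul]

end Rho

/-! ## §2 The `C`-step of the glue: `locd₂ (C a • x) = c • locd₂ x` from `proj_C_smul` -/

section Glue

variable {p : ℕ} [Fact p.Prime] {A : Type} [CommRing A] [TopologicalSpace A] {M : Type} [AddCommGroup M] [Module A M]
  [TopologicalSpace M] [IsTopologicalAddGroup M] [ContinuousSMul A M] {T : GaloisRep ℚ A M}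
  {κ : ZpExtension ℚ p} {γ : absoluteGaloisGroup ℚ} (I : IwasawaH1DataCoeff T p κ γ)
  (W : WeierstrassCurve ℚ) (v : HeightOneSpectrum (𝓞 ℚ)) {r : ℕ}
  {pair : ∀ n : ℕ, H1 T (κ.layerSubgroup n) →+
    ((Fin r → localLayerPointsOfEmb κ (closureEmb (K := ℚ) (v.adicCompletion ℚ)) W n) →+ ℤ_[p])}
  {locd₂ : I.H →+ ((Fin r → localTowerPointsOfEmb κ (closureEmb (K := ℚ) (v.adicCompletion ℚ)) W) →+ ℤ_[p])}
  {a : A} {c : ℤ_[p]}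
  (hPC : ∀ (n : ℕ) (y : H1 T (κ.layerSubgroup n)) (Q : Fin r → localLayerPointsOfEmb κ (closureEmb (K := ℚ) (v.adicCompletion ℚ)) W n),
    pair n (a • y) Q = c * pair n y Q)
  (hlocd : ∀ (n : ℕ) (x : I.H) (Q : Fin r → localPoints W (v.adicCompletion ℚ))
    (hQ : ∀ i, Q i ∈ localLayerPointsOfEmb κ (closureEmb (K := ℚ) (v.adicCompletion ℚ)) W n),
    locd₂ x (fun i => ⟨Q i, localLayerPointsOfEmb_le_localTowerPointsOfEmb κ _ W n (hQ i)⟩) = pair n (I.proj n x) (fun i => ⟨Q i, hQ i⟩))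

include hPC hlocd in
/-- **The `C`-step: `locd₂ (C a • x) Q = c · locd₂ x Q`** for a scalar `a ∈ A` acting on the layer pairings as `c ∈ ℤ_p` (`hPC`; for the pinned `ρ`-pairings and
`a = ι c` this is `pair_padicInt_smul_of_toZModPow`): constants act through the `A`-structure of the layers (`IwasawaH1DataCoeff.proj_C_smul`). The
`ρ`/tuple twin of TP2's `ColGlue.col_C_smul`. [cite: Kato2004Asterisque, §12.2 (p. 220), §13.8 (p. 228)] -/
theorem locd₂_C_smul (x : I.H) (Q : Fin r → localTowerPointsOfEmb κ (closureEmb (K := ℚ) (v.adicCompletion ℚ)) W) :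
    locd₂ ((PowerSeries.C a : PowerSeries A) • x) Q = c * locd₂ x Q := by
  obtain ⟨n, hn⟩ := exists_common_layer W v Q
  have e : Q = fun i => (⟨(Q i : localPoints W (v.adicCompletion ℚ)),
      localLayerPointsOfEmb_le_localTowerPointsOfEmb κ _ W n (hn i)⟩ : localTowerPointsOfEmb κ (closureEmb (K := ℚ) (v.adicCompletion ℚ)) W) :=
    funext fun i => Subtype.ext rfl
  rw [e, hlocd n _ _ hn, hlocd n x _ hn, I.proj_C_smul, hPC]

include hPC hlocd in
/-- The `C`-step on `Hom((Fin r → E(ℚ_{∞,v})), ℤ_p)`: `locd₂ (C a • x) = c • locd₂ x`. [cite: Kato2004Asterisque, §12.2 (p. 220)] -/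
theorem locd₂_C_smul_eq_smul (x : I.H) : locd₂ ((PowerSeries.C a : PowerSeries A) • x) = c • locd₂ x :=
  AddMonoidHom.ext fun Q => by rw [locd₂_C_smul I W v hPC hlocd, AddMonoidHom.smul_apply, smul_eq_mul]

include hPC hlocd in
/-- **LIN-C₀ for `𝒸 = col^{⊕r} ∘ locd₂`: `𝒸 (C a • x) = c • 𝒸 x`** for any `ℤ_p`-linear `col` on `Hom(E(ℚ_{∞,v}), ℤ_p)` (card k3-g12 `hC` / STUB-PLAN rev 17 S72, piece
S2; with `pair_padicInt_smul_of_toZModPow` for the `pair`-half). [cite: Kato2004Asterisque, §12.2 (p. 220), §17.13 (p. 279)] [cite: Kobayashi2003, §8 (8.20)–(8.23)] -/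
theorem colTuple_locd₂_C_smul {V : Type*} [AddCommGroup V] [Module ℤ_[p] V]
    (col : (localTowerPointsOfEmb κ (closureEmb (K := ℚ) (v.adicCompletion ℚ)) W →+ ℤ_[p]) →ₗ[ℤ_[p]] V) (x : I.H) :
    (fun i : Fin r => col ((locd₂ ((PowerSeries.C a : PowerSeries A) • x)).comp
        (AddMonoidHom.single (fun _ : Fin r => ↥(localTowerPointsOfEmb κ (closureEmb (K := ℚ) (v.adicCompletion ℚ)) W)) i))) =
      c • fun i : Fin r => col ((locd₂ x).comp
        (AddMonoidHom.single (fun _ : Fin r => ↥(localTowerPointsOfEmb κ (closureEmb (K := ℚ) (v.adicCompletion ℚ)) W)) i)) := by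
  funext i
  rw [Pi.smul_apply, ← map_smul, locd₂_C_smul_eq_smul I W v hPC hlocd]
  congr 1

end Glue

end Summit.BirchSwinnertonDyer.BirchSwinnertonDyer.Theorems.ThetaTransport

end
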